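import Summits.ValiantsHypothesis.ValiantsHypothesis.Theses.FreeSubtorus

/-!
# ValiantsHypothesis / FreeSubtorus — item `Assembly` (stmt-ValiantsHypothesis-16136), closed

The assembly item of route `FreeSubtorus` is literally the type of the route's deciding theorem
`Theses.FreeSubtorus.closes` (OrbitDimensionBound → SubtorusCovering → ValiantsHypothesis); it is proved by `closes` itself. HONEST FRAMING: bookkeeping; the
hypotheses are OPEN cruxes; nothing here is progress on `VP ≠ VNP`.
-/

-- layout Summits/ValiantsHypothesis/ValiantsHypothesis forces the duplicated namespace component
set_option linter.dupNamespace false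

namespace Summit.ValiantsHypothesis.ValiantsHypothesis.Theorems.FreeSubtorus

/-- **Item `Assembly` (stmt-ValiantsHypothesis-16136):** OrbitDimensionBound → SubtorusCovering → ValiantsHypothesis — the route's deciding theorem `closes`. [folklore] -/
theorem assembly_proof : Theses.FreeSubtorus.Assembly := by
  unfold Theses.FreeSubtorus.Assembly
  exact fun h₁ h₂ => Theses.FreeSubtorus.closes h₁ h₂

end Summit.ValiantsHypothesis.ValiantsHypothesis.Theorems.FreeSubtorus
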